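import Summits.QuantumFields.YangMills.Theorems.BalabanUVNodesN15FullPropagatorByPartsNode
import Summits.QuantumFields.YangMills.Theorems.BalabanUVNodesN15TwoGridAveragingDefect
import Literature.MathematicalPhysics.QuantumFieldTheory.Balaban1983to89.B9Eq3130MatrixLetters

/-!
# Route «BalabanUVNodes», cluster K4 «SpineRates» — node N15 = NE2, UNIT-LATTICE LAYER WITH THE BACKGROUND LIVE, file U-C (dag-n15-a g16, LOCATED-1):
# THE MIDDLE FACTOR `Z(U) = Q_k(E₀^{(k)}(U) − G_k)Q_k*` ON THE UNIT TORUS — the block-averaged increment of the operator layer's OWN background-dressed full `U ≡ 1`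
# propagator: its block majorant (small in the coefficient letters), its gradient letter, and the η-difference `Z′(U) − Z(Ū)` from the operator layer's entry-0 defect
# — ONE TORUS, EXPLICIT LETTERS (the family version with uniform constants is file U-C2)

Cell `pub-ymgap`, seat `pub-ymgap-dag-n15-a` (-a KNIT-BY-NAME seat of node N15; HUMAN RULING D-0062; chair R424 venue), generation 16, file U-C of the LOCATED-1
programme (INBOX l.22312 ∕ l.22757).  `bears_on: R4∕N15 · K3⁷ SpineGivenEndpointR13SepCoPH (stmt-QuantumFields-20544)`.  Filed `--kind proof --supports stmt-QuantumFields-20544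
--as helper` — COUNT-NEUTRAL.  Three data `def`s (`e0Op`, `wOp`, `zOp`), the rest theorems; 0 `sorry`.  Imports BY NAME dag-n15-c FILE 8 `…N15FullPropagatorByPartsNode`
(`fgD`; through it n15-b B2 `bgPair`, `projO`, `stack`∕`unstack`, `projO_none_bgPair`, `hasMaj_stack`, `hasMaj_unstack`, B1a `isUnit_stepV`, `hasMaj_V_bgPropV`, FILE 4
`symbOp_sD_eq`), this seat's part 45 `…N15TwoGridAveragingDefect` (`hasMaj_qvRe_comp`, `hasMaj_qvAdjRe_comp`, `hasMaj_qvAdjRe_sub_pull_comp`, `hasMaj_qvRe_pull_sub_comp`; part 37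
`qvRe`, `qvAdjRe`; part 39 `gOp`) and lit `B9Eq3130MatrixLetters` (`hasMaj_id_ofBlocks`); nothing in the tree is modified.

WHAT.  On one unit torus `Tor M` (fine lattices `Tor (fine n M) × Fin (d+1)`, King's blocks, `Q_n = qvRe M n` Bałaban's (1.18) averaging, real parts):
* §1 def `e0Op M n b c a := projO none ∘ bgPair (gOp M n b) (fgD d M n b) c a` — THE OPERATOR LAYER's OWN background-dressed full propagator `E₀(U)` (n15-c FILE 8's entry-0 object
  at the coefficient pair `(c, a)`), def `wOp := e0Op − gOp` (the increment `E₀(U) − G`), def `zOp := Q_n ∘ wOp ∘ Q_n*` (THE MIDDLE FACTOR of file U-B's dressing); `wOp_eq_comp`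
  ((3.65): `E₀ − G = G∘(V̂∘X̂)`), `e0Op_zero`∕`wOp_zero`∕`zOp_zero` (no background, no increment);
* §2 ★ `hasMaj_wOp` (block majorant of the increment, LINEAR in the coefficient sup letter `r`: `≤ β·(R·β(1−βRc_r)⁻¹)·c_r·e^{−ρd}`, `R = r(1+(d+1))`, from the `U ≡ 1` letters of
  `G, ∇_μG` — B1a `hasMaj_V_bgPropV` after B2 `hasMaj_stack`∕`hasMaj_unstack`), ★ `hasMaj_zOp` (the middle factor on unit 1-forms blocked by their site, parts 45's `Q`∕`Q*` transfers),
  ★ `hasMaj_grad_wOp_qvAdj` (the GRADIENT letter `(L^k)⁻¹ρ(sD_κ)∘(E₀ − G)∘Q* ≤ (L^k)⁻¹·(…)·e^{−ρd}` — gain `(L^k)⁻¹` from `∇_κG`'s own majorant, FILE 4 `symbOp_sD_eq`);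
* §3 `zOp_sub_eq` (the three-term split `Z′ − Z = Q′W′(Q′* − PQ*) + Q′(W′P − PW)Q* + (Q′P − Q)WQ*`, `P = pull kingPrV`), `idef_sub_sub` (`𝔇(W′,W) = 𝔇(E₀′,E₀) − 𝔇(G′,G)`),
  ★★ `hasMaj_zOp_sub` (the η-DIFFERENCE of the middle factor from: the two increments' majorants, the operator layer's background-live entry-0 defect `𝔇(E₀′(U), E₀(Ū))` MINUS
  entry 0 `𝔇(G′,G)` — as ONE hypothesis `hE` on `𝔇(W′,W)` —, and the gradient letter; every term carries a gain: `2∕L^k` (part 45 `Q′* − PQ*`), the defect letter, `(L^k)⁻¹`).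

HONEST FRAMING.  Block-majorant algebra on one torus, count-neutral; the objects are the by-parts family's (n15-c∕n15-b: MODEL-LEVEL species — abelianised first-order
coefficients, block-averaged coarse partner; GENUINE full `U ≡ 1` Landau-gauge propagator `gOp`); `Q` abelianised (model).  No uniform constants are chosen here (file U-C2).
NOT [B9] Thm 3.15 at a general `U`; N15 NOT discharged (typed 28∕28 · discharged 5∕27 of record unchanged); nothing continuum ∕ ℝ⁴ ∕ OS ∕ mass-gap ∕ Clay.  Restate-immune.
-/

set_option autoImplicit false

noncomputable section

open scoped BigOperators
open Finset

namespace Summit.QuantumFields.YangMills.BalabanUVNodes.N15.UnitLayerBg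

open Literature.MathematicalPhysics.QuantumFieldTheory.Balaban1983to89
open Literature.MathematicalPhysics.QuantumFieldTheory.Balaban1983to89.B11SectG (BlockNorm HasMaj RowSum hasMaj_comp_exp)
open Literature.MathematicalPhysics.QuantumFieldTheory.Balaban1983to89.T4EtaRateDefect (idef)
open Literature.MathematicalPhysics.QuantumFieldTheory.Balaban1983to89.T4EtaRateCoeffDefect (pull diagK diagK_nonneg)
open Literature.MathematicalPhysics.QuantumFieldTheory.Balaban1983to89.B5Prop11Plancherel (Tor fine)
open Literature.MathematicalPhysics.QuantumFieldTheory.Balaban1983to89.B6UnitTorusCarrier (unitTorusGeo triangle254_unitTorusGeo rowSum_unitTorusGeo unitTorusGeo_dist_nonneg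
  unitTorusGeo_dist_self)
open Literature.MathematicalPhysics.QuantumFieldTheory.Balaban1983to89.B4Sect5Proof (latticeConst latticeConst_nonneg)
open Literature.MathematicalPhysics.QuantumFieldTheory.Balaban1983to89.B9Eq3130MatrixLetters (hasMaj_id_ofBlocks)
open Literature.MathematicalPhysics.QuantumFieldTheory.King1986.Torus (blockOf tdistT tdistT_nonneg tdistT_self)
open Summit.QuantumFields.YangMills.BalabanUVNodes.N15.TwoGrid (gOp symbOp sD qvRe qvAdjRe hasMaj_qvRe_comp hasMaj_qvAdjRe_comp hasMaj_qvAdjRe_sub_pull_comp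
  hasMaj_qvRe_pull_sub_comp hasMaj_smul_ofBlocks)
open Summit.QuantumFields.YangMills.BalabanUVNodes.N15.VectorPiece (blkFine kingPrV blkFine_comp_kingPrV bshiftEquiv)
open Summit.QuantumFields.YangMills.BalabanUVNodes.N15.BackgroundLayer (bgPair projO stack unstack blkPair projO_none_bgPair hasMaj_stack hasMaj_unstack isUnit_stepV
  hasMaj_V_bgPropV fgD symbOp_sD_eq)
open Summit.QuantumFields.YangMills.BalabanUVNodes.N15.BackgroundModel (kappa_ofBlocks)

variable {d : ℕ} {L : ℕ} (M : Fin (d + 1) → ℕ) [∀ μ, NeZero (M μ)]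

/-! ## §1 The dressed propagator, its increment and the middle factor -/

section Defs

variable (n : ℕ) [NeZero n] (b : ℝ)

variable (d) in
/-- THE OPERATOR LAYER's OWN BACKGROUND-DRESSED FULL `U ≡ 1` PROPAGATOR `E₀(U)` at fineness `n` and coefficient pair `U = (c, a_μ)`: the propagator component of n15-b's
first-order pair `X̂ = (1 − ĜV̂)⁻¹Ĝ` built on `Ĝ = (G, ∇_μG)` with `G = gOp` (dag-n15-c FILE 8's entry-0 object). [cite: Balaban1985BackgroundPropagators, (3.64)–(3.65) p.403 (shape)] -/
def e0Op (c : Tor (fine n M) × Fin (d + 1) → ℝ) (a : Fin (d + 1) → Tor (fine n M) × Fin (d + 1) → ℝ) :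
    (Tor (fine n M) × Fin (d + 1) → ℝ) →ₗ[ℝ] (Tor (fine n M) × Fin (d + 1) → ℝ) :=
  projO none ∘ₗ bgPair (gOp M n b) (fgD d M n b) c a

variable (d) in
/-- THE INCREMENT `W(U) = E₀(U) − G`. [cite: Balaban1985BackgroundPropagators, (3.65) p.403 (shape)] -/
def wOp (c : Tor (fine n M) × Fin (d + 1) → ℝ) (a : Fin (d + 1) → Tor (fine n M) × Fin (d + 1) → ℝ) :
    (Tor (fine n M) × Fin (d + 1) → ℝ) →ₗ[ℝ] (Tor (fine n M) × Fin (d + 1) → ℝ) :=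
  e0Op d M n b c a - gOp M n b

variable (d) in
/-- THE MIDDLE FACTOR `Z(U) = Q_n(E₀(U) − G)Q_n*` on unit-lattice 1-forms (`Q_n = qvRe`, `Q_n* = qvAdjRe`: Bałaban's (1.18) averaging, real parts, ABELIANISED — model).
[cite: Balaban1984PropagatorsI, (1.18) p.20, (1.65)–(1.66) p.29 (objects)] -/
def zOp (c : Tor (fine n M) × Fin (d + 1) → ℝ) (a : Fin (d + 1) → Tor (fine n M) × Fin (d + 1) → ℝ) :
    (Tor M × Fin (d + 1) → ℝ) →ₗ[ℝ] (Tor M × Fin (d + 1) → ℝ) :=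
  qvRe M n ∘ₗ (wOp d M n b c a ∘ₗ qvAdjRe M n)

/-- **(3.65) FOR THE INCREMENT**: when `1 − [ĜV̂]` is a unit, `E₀(U) − G = G∘(V̂∘X̂)` (`projO_none_bgPair`). [cite: Balaban1985BackgroundPropagators, (3.65) p.403 (shape)] -/
theorem wOp_eq_comp {c : Tor (fine n M) × Fin (d + 1) → ℝ} {a : Fin (d + 1) → Tor (fine n M) × Fin (d + 1) → ℝ}
    (hunit : IsUnit (1 - LinearMap.toMatrix' (stack (gOp M n b) (fgD d M n b) ∘ₗ unstack c a))) :
    wOp d M n b c a = gOp M n b ∘ₗ (unstack c a ∘ₗ bgPair (gOp M n b) (fgD d M n b) c a) := by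
  unfold wOp e0Op
  rw [projO_none_bgPair hunit, add_sub_cancel_left]

end Defs

/-! ## §2 The increment's majorant (linear in the coefficient letter), the middle factor's, and the gradient letter -/

section Majorants

variable {M} (k : ℕ) {n : ℕ} [NeZero n] {b : ℝ} (blkC : Tor (fine n M) × Fin (d + 1) → Tor M)
variable {c : Tor (fine n M) × Fin (d + 1) → ℝ} {a : Fin (d + 1) → Tor (fine n M) × Fin (d + 1) → ℝ} {β δ r σ ρ : ℝ}

/-- THE COEFFICIENT AMPLITUDE `R = r(1 + (d+1))` of the unstacked perturbation (B2 `hasMaj_unstack`). [folklore] -/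
theorem card_letter : (1 : ℝ) + Fintype.card (Fin (d + 1)) = (d : ℝ) + 2 := by
  rw [Fintype.card_fin]; push_cast; ring

/-- THE UNIT `1 − [ĜV̂]` of the first-order pair (B1a `isUnit_stepV` after B2 `hasMaj_stack`∕`hasMaj_unstack`) under the guard `q = β·r(d+2)·c_r(σ) < 1`, `σ ≤ δ`.
[cite: Balaban1985BackgroundPropagators, (3.63)–(3.64) pp.402–403 (mechanism)] -/
theorem isUnit_pair (hβ : 0 ≤ β) (hr : 0 ≤ r) (hσ : 0 < σ) (hσδ : σ ≤ δ)
    (hG : HasMaj (BlockNorm.ofBlocks (unitTorusGeo L k M) blkC) (BlockNorm.ofBlocks (unitTorusGeo L k M) blkC) (gOp M n b)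
      (fun y y' => β * Real.exp (-(δ * tdistT M y y'))))
    (hD : ∀ μ, HasMaj (BlockNorm.ofBlocks (unitTorusGeo L k M) blkC) (BlockNorm.ofBlocks (unitTorusGeo L k M) blkC) (fgD d M n b μ)
      (fun y y' => β * Real.exp (-(δ * tdistT M y y'))))
    (hc : ∀ x, |c x| ≤ r) (ha : ∀ μ x, |a μ x| ≤ r) (hq : β * (r * ((d : ℝ) + 2)) * latticeConst (d + 1) σ < 1) :
    IsUnit (1 - LinearMap.toMatrix' (stack (gOp M n b) (fgD d M n b) ∘ₗ unstack c a)) := by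
  have hd := unitTorusGeo_dist_nonneg (L := L) (k := k) (M := M)
  have hrow := rowSum_unitTorusGeo (L := L) (k := k) (M := M) hσ
  have hR : 0 ≤ r * ((d : ℝ) + 2) := by positivity
  have hGs : HasMaj (BlockNorm.ofBlocks (unitTorusGeo L k M) blkC) (BlockNorm.ofBlocks (unitTorusGeo L k M) (blkPair blkC))
      (stack (gOp M n b) (fgD d M n b)) (fun y y' => β * Real.exp (-(δ * tdistT M y y'))) :=
    hasMaj_stack (g := unitTorusGeo L k M) blkC (fun _ _ => mul_nonneg hβ (Real.exp_nonneg _)) hG hD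
  have hV : HasMaj (BlockNorm.ofBlocks (unitTorusGeo L k M) (blkPair blkC)) (BlockNorm.ofBlocks (unitTorusGeo L k M) blkC) (unstack c a)
      (diagK fun _ => r * ((d : ℝ) + 2)) := by
    have h := hasMaj_unstack (g := unitTorusGeo L k M) blkC hr hc ha
    rwa [card_letter] at h
  exact isUnit_stepV (g := unitTorusGeo L k M) blkC (blkPair blkC) hd hrow hσδ hβ hR hGs hV hq

/-- **`V̂∘X̂ ≤ r(d+2)·β(1−q)⁻¹·e^{−ρd}`** — B1a's binder (c) for the first-order pair on `G = gOp` (`ρ + σ ≤ δ`). [cite: Balaban1985BackgroundPropagators, (3.63) p.402 (shape)] -/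
theorem hasMaj_VX (hβ : 0 ≤ β) (hr : 0 ≤ r) (hσ : 0 < σ) (hρ : 0 ≤ ρ) (hρδ : ρ + σ ≤ δ)
    (hG : HasMaj (BlockNorm.ofBlocks (unitTorusGeo L k M) blkC) (BlockNorm.ofBlocks (unitTorusGeo L k M) blkC) (gOp M n b)
      (fun y y' => β * Real.exp (-(δ * tdistT M y y'))))
    (hD : ∀ μ, HasMaj (BlockNorm.ofBlocks (unitTorusGeo L k M) blkC) (BlockNorm.ofBlocks (unitTorusGeo L k M) blkC) (fgD d M n b μ)
      (fun y y' => β * Real.exp (-(δ * tdistT M y y'))))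
    (hc : ∀ x, |c x| ≤ r) (ha : ∀ μ x, |a μ x| ≤ r) (hq : β * (r * ((d : ℝ) + 2)) * latticeConst (d + 1) σ < 1) :
    HasMaj (BlockNorm.ofBlocks (unitTorusGeo L k M) blkC) (BlockNorm.ofBlocks (unitTorusGeo L k M) blkC)
      (unstack c a ∘ₗ bgPair (gOp M n b) (fgD d M n b) c a)
      (fun y y' => r * ((d : ℝ) + 2) * (β * (1 - β * (r * ((d : ℝ) + 2)) * latticeConst (d + 1) σ)⁻¹) * Real.exp (-(ρ * tdistT M y y'))) := by
  have htri := triangle254_unitTorusGeo (L := L) (k := k) (M := M)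
  have hd := unitTorusGeo_dist_nonneg (L := L) (k := k) (M := M)
  have hrow := rowSum_unitTorusGeo (L := L) (k := k) (M := M) hσ
  have hR : 0 ≤ r * ((d : ℝ) + 2) := by positivity
  have hGs : HasMaj (BlockNorm.ofBlocks (unitTorusGeo L k M) blkC) (BlockNorm.ofBlocks (unitTorusGeo L k M) (blkPair blkC))
      (stack (gOp M n b) (fgD d M n b)) (fun y y' => β * Real.exp (-(δ * tdistT M y y'))) :=
    hasMaj_stack (g := unitTorusGeo L k M) blkC (fun _ _ => mul_nonneg hβ (Real.exp_nonneg _)) hG hD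
  have hV : HasMaj (BlockNorm.ofBlocks (unitTorusGeo L k M) (blkPair blkC)) (BlockNorm.ofBlocks (unitTorusGeo L k M) blkC) (unstack c a)
      (diagK fun _ => r * ((d : ℝ) + 2)) := by
    have h := hasMaj_unstack (g := unitTorusGeo L k M) blkC hr hc ha
    rwa [card_letter] at h
  exact hasMaj_V_bgPropV (g := unitTorusGeo L k M) blkC (blkPair blkC) htri hd hrow hσ.le hρ hρδ hβ hR hGs hV hq

/-- ★ **THE INCREMENT IS SMALL AND DECAYS**: from the `U ≡ 1` block majorants `β·e^{−δd}` of `G` and `∇_μG` (one grid, blocks `blkC`), the coefficient sup letters `|c|, |a_μ| ≤ r`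
and the guard `q = β·r(d+2)·c_r(σ) < 1` (`c_r(σ)` = the unit torus' row-sum constant at rate `σ`, `ρ + σ ≤ δ`): `E₀(U) − G ≤ β·(r(d+2)·β(1−q)⁻¹)·c_r·e^{−ρd}` — LINEAR in `r`.
[cite: Balaban1985BackgroundPropagators, (3.63)–(3.65) pp.402–403 (mechanism)] -/
theorem hasMaj_wOp (hβ : 0 ≤ β) (hr : 0 ≤ r) (hσ : 0 < σ) (hρ : 0 ≤ ρ) (hρδ : ρ + σ ≤ δ)
    (hG : HasMaj (BlockNorm.ofBlocks (unitTorusGeo L k M) blkC) (BlockNorm.ofBlocks (unitTorusGeo L k M) blkC) (gOp M n b)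
      (fun y y' => β * Real.exp (-(δ * tdistT M y y'))))
    (hD : ∀ μ, HasMaj (BlockNorm.ofBlocks (unitTorusGeo L k M) blkC) (BlockNorm.ofBlocks (unitTorusGeo L k M) blkC) (fgD d M n b μ)
      (fun y y' => β * Real.exp (-(δ * tdistT M y y'))))
    (hc : ∀ x, |c x| ≤ r) (ha : ∀ μ x, |a μ x| ≤ r) (hq : β * (r * ((d : ℝ) + 2)) * latticeConst (d + 1) σ < 1) :
    HasMaj (BlockNorm.ofBlocks (unitTorusGeo L k M) blkC) (BlockNorm.ofBlocks (unitTorusGeo L k M) blkC) (wOp d M n b c a)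
      (fun y y' => β * (r * ((d : ℝ) + 2) * (β * (1 - β * (r * ((d : ℝ) + 2)) * latticeConst (d + 1) σ)⁻¹)) * latticeConst (d + 1) σ *
        Real.exp (-(ρ * tdistT M y y'))) := by
  have htri := triangle254_unitTorusGeo (L := L) (k := k) (M := M)
  have hd := unitTorusGeo_dist_nonneg (L := L) (k := k) (M := M)
  have hrow := rowSum_unitTorusGeo (L := L) (k := k) (M := M) hσ
  have hunit := isUnit_pair k blkC hβ hr hσ (by linarith) hG hD hc ha hq
  have hVX := hasMaj_VX k blkC hβ hr hσ hρ hρδ hG hD hc ha hq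
  rw [wOp_eq_comp M n b hunit]
  have key := hasMaj_comp_exp htri hd hrow hβ (by positivity) hρ le_rfl hρδ hG hVX
  refine key.mono fun y y' => le_of_eq ?_
  rw [kappa_ofBlocks, one_mul]


variable {k blkC}

/-- `Q_n*` ALONE: the identity has the majorant `1·e^{−ρd}` on the unit lattice blocked by sites (`hasMaj_id_ofBlocks`), so `Q_n* = Q_n*∘id ≤ e^{ρ}·e^{−ρd}` into King's blocks
(part 45 `hasMaj_qvAdjRe_comp`). [cite: Balaban1984PropagatorsI, (1.18) p.20 (the stencil)] -/
theorem hasMaj_qvAdjRe (hρ : 0 ≤ ρ) :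
    HasMaj (BlockNorm.ofBlocks (unitTorusGeo L k M) (fun bb : Tor M × Fin (d + 1) => bb.1))
      (BlockNorm.ofBlocks (unitTorusGeo L k M) (fun i : Tor (fine n M) × Fin (d + 1) => blockOf n M i.1)) (qvAdjRe M n)
      (fun y y' => 1 * Real.exp ρ * Real.exp (-(ρ * tdistT M y y'))) := by
  have hid := hasMaj_id_ofBlocks (g := unitTorusGeo L k M) (fun bb : Tor M × Fin (d + 1) => bb.1) (unitTorusGeo_dist_self (L := L) (k := k) (M := M)) ρ
  have h := hasMaj_qvAdjRe_comp M k n zero_le_one hρ hid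
  rwa [LinearMap.comp_id] at h

/-- ★ **THE MIDDLE FACTOR's BLOCK MAJORANT** on unit 1-forms blocked by their site: `W ≤ β_W·e^{−ρd}` (King's blocks, `0 < σ ≤ ρ`) ⟹
`Z = Q_nWQ_n* ≤ (e^{ρ−σ}·β_W·e^{ρ}·c_r(σ))·e^{−(ρ−σ)d}` (parts 45's transfers + one row sum). [cite: Balaban1984PropagatorsI, (1.18) p.20; Balaban1984PropagatorsII, (2.52)–(2.56) pp.232–233] -/
theorem hasMaj_zOp {βW : ℝ} (hβW : 0 ≤ βW) (hσ : 0 < σ) (hσρ : σ ≤ ρ)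
    (hW : HasMaj (BlockNorm.ofBlocks (unitTorusGeo L k M) (fun i : Tor (fine n M) × Fin (d + 1) => blockOf n M i.1))
      (BlockNorm.ofBlocks (unitTorusGeo L k M) (fun i : Tor (fine n M) × Fin (d + 1) => blockOf n M i.1)) (wOp d M n b c a)
      (fun y y' => βW * Real.exp (-(ρ * tdistT M y y')))) :
    HasMaj (BlockNorm.ofBlocks (unitTorusGeo L k M) (fun bb : Tor M × Fin (d + 1) => bb.1)) (BlockNorm.ofBlocks (unitTorusGeo L k M) (fun bb : Tor M × Fin (d + 1) => bb.1))
      (zOp d M n b c a)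
      (fun y y' => 1 * βW * (1 * Real.exp ρ) * latticeConst (d + 1) σ * Real.exp (ρ - σ) * Real.exp (-((ρ - σ) * tdistT M y y'))) := by
  have htri := triangle254_unitTorusGeo (L := L) (k := k) (M := M)
  have hd := unitTorusGeo_dist_nonneg (L := L) (k := k) (M := M)
  have hrow := rowSum_unitTorusGeo (L := L) (k := k) (M := M) hσ
  have hρ : 0 ≤ ρ := hσ.le.trans hσρ
  have hQ := hasMaj_qvAdjRe (L := L) (M := M) (k := k) (n := n) hρ
  have hWQ := hasMaj_comp_exp htri hd hrow hβW (by positivity) (ρ := ρ - σ) (by linarith) (by linarith) (by linarith) hW hQ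
  have hZ := hasMaj_qvRe_comp M k n (B := 1 * βW * (1 * Real.exp ρ) * latticeConst (d + 1) σ) (ρ := ρ - σ)
    (by have := latticeConst_nonneg (d + 1) hσ.le; positivity) (by linarith) (by
      refine hWQ.mono fun y y' => le_of_eq ?_
      rw [kappa_ofBlocks])
  exact hZ

end Majorants

section Gradient

variable {M} (k : ℕ) {b : ℝ} [NeZero L]
variable {c : Tor (fine (L ^ k) M) × Fin (d + 1) → ℝ} {a : Fin (d + 1) → Tor (fine (L ^ k) M) × Fin (d + 1) → ℝ} {β δ σ ρ : ℝ}

/-- ★ **THE GRADIENT LETTER OF THE INCREMENT** (coarse grid `n = L^k`, King's blocks `blkFine`): from `E₀ − G = G∘(V̂∘X̂)` (`wOp_eq_comp`), `ρ(sD_κ)∘G = ∇_κG` (FILE 4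
`symbOp_sD_eq`, n15-c `fgD`) and the majorants `∇_κG ≤ β·e^{−δd}`, `V̂∘X̂ ≤ A·e^{−ρd}` (`σ ≤ ρ`, `ρ + σ ≤ δ`... here as the hypothesis shapes):
`(L^k)⁻¹ρ(sD_κ)∘(E₀ − G)∘Q* ≤ (L^k)⁻¹·(β·A·e^{ρ}·c_r²·e^{…})·e^{−(ρ−σ)d}` — the GAIN `(L^k)⁻¹` that the two-grid defect of `Q` costs (part 45 `hasMaj_qvRe_pull_sub_comp`).
[cite: Balaban1984PropagatorsI, Prop. 1.2 (1.110) p.35 (the entry `∇GJ`: shape)] -/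
theorem hasMaj_grad_wOp_qvAdj {A : ℝ} (hβ : 0 ≤ β) (hA : 0 ≤ A) (hσ : 0 < σ) (hσρ : σ ≤ ρ) (hρδ : ρ + σ ≤ δ)
    (hunit : IsUnit (1 - LinearMap.toMatrix' (stack (gOp M (L ^ k) b) (fgD d M (L ^ k) b) ∘ₗ unstack c a)))
    (hD : ∀ μ, HasMaj (BlockNorm.ofBlocks (unitTorusGeo L k M) (blkFine L k M)) (BlockNorm.ofBlocks (unitTorusGeo L k M) (blkFine L k M)) (fgD d M (L ^ k) b μ)
      (fun y y' => β * Real.exp (-(δ * tdistT M y y'))))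
    (hVX : HasMaj (BlockNorm.ofBlocks (unitTorusGeo L k M) (blkFine L k M)) (BlockNorm.ofBlocks (unitTorusGeo L k M) (blkFine L k M))
      (unstack c a ∘ₗ bgPair (gOp M (L ^ k) b) (fgD d M (L ^ k) b) c a) (fun y y' => A * Real.exp (-(ρ * tdistT M y y'))))
    (κ : Fin (d + 1)) :
    HasMaj (BlockNorm.ofBlocks (unitTorusGeo L k M) (fun bb : Tor M × Fin (d + 1) => bb.1)) (BlockNorm.ofBlocks (unitTorusGeo L k M) (blkFine L k M))
      ((((L ^ k : ℕ) : ℝ)⁻¹ • symbOp M (L ^ k) (sD M (L ^ k) κ ((L ^ k : ℕ) : ℝ))) ∘ₗ (wOp d M (L ^ k) b c a ∘ₗ qvAdjRe M (L ^ k)))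
      (fun y y' => ((L ^ k : ℕ) : ℝ)⁻¹ * (1 * β * (1 * A * (1 * Real.exp ρ) * latticeConst (d + 1) σ) * latticeConst (d + 1) σ) *
        Real.exp (-((ρ - σ) * tdistT M y y'))) := by
  have htri := triangle254_unitTorusGeo (L := L) (k := k) (M := M)
  have hd := unitTorusGeo_dist_nonneg (L := L) (k := k) (M := M)
  have hrow := rowSum_unitTorusGeo (L := L) (k := k) (M := M) hσ
  have hρ : 0 ≤ ρ := hσ.le.trans hσρ
  have hK0 := latticeConst_nonneg (d + 1) hσ.le
  -- Q* into King's blocks = blkFine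
  have hQ : HasMaj (BlockNorm.ofBlocks (unitTorusGeo L k M) (fun bb : Tor M × Fin (d + 1) => bb.1)) (BlockNorm.ofBlocks (unitTorusGeo L k M) (blkFine L k M))
      (qvAdjRe M (L ^ k)) (fun y y' => 1 * Real.exp ρ * Real.exp (-(ρ * tdistT M y y'))) := hasMaj_qvAdjRe (L := L) (M := M) (k := k) (n := L ^ k) hρ
  have hVXQ := hasMaj_comp_exp htri hd hrow hA (by positivity) (ρ := ρ - σ) (by linarith) (by linarith) (by linarith) hVX hQ
  have hDVXQ := hasMaj_comp_exp htri hd hrow hβ (by rw [kappa_ofBlocks]; positivity) (ρ := ρ - σ) (by linarith) le_rfl (by linarith) (hD κ) hVXQ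
  -- the operator identity: (n⁻¹•ρ(sD_κ)) ∘ (W ∘ Q*) = n⁻¹ • (∇_κG ∘ (V̂X̂ ∘ Q*))
  have e : (((L ^ k : ℕ) : ℝ)⁻¹ • symbOp M (L ^ k) (sD M (L ^ k) κ ((L ^ k : ℕ) : ℝ))) ∘ₗ (wOp d M (L ^ k) b c a ∘ₗ qvAdjRe M (L ^ k)) =
      ((L ^ k : ℕ) : ℝ)⁻¹ • (fgD d M (L ^ k) b κ ∘ₗ ((unstack c a ∘ₗ bgPair (gOp M (L ^ k) b) (fgD d M (L ^ k) b) c a) ∘ₗ qvAdjRe M (L ^ k))) := by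
    rw [wOp_eq_comp M (L ^ k) b hunit, LinearMap.smul_comp, fgD, ← symbOp_sD_eq]
    simp only [LinearMap.comp_assoc]
  rw [e]
  refine (hasMaj_smul_ofBlocks (g := unitTorusGeo L k M) (blkFine L k M) (fun y y' => ?_) (((L ^ k : ℕ) : ℝ)⁻¹) hDVXQ).mono fun y y' => le_of_eq ?_
  · simp only [kappa_ofBlocks]; positivity
  · have h0 : (0 : ℝ) ≤ (((L ^ k : ℕ) : ℝ))⁻¹ := by positivity
    simp only [kappa_ofBlocks, abs_of_nonneg h0]
    show _ = _ * Real.exp (-((ρ - σ) * tdistT M y y'))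
    ring

end Gradient

/-! ## §3 The η-difference of the middle factor: the three-term split and its majorant -/

section Difference

variable {M} (k m : ℕ) {b : ℝ} [NeZero L]
variable {c : Tor (fine (L ^ k) M) × Fin (d + 1) → ℝ} {a : Fin (d + 1) → Tor (fine (L ^ k) M) × Fin (d + 1) → ℝ}
variable {c' : Tor (fine (L ^ m * L ^ k) M) × Fin (d + 1) → ℝ} {a' : Fin (d + 1) → Tor (fine (L ^ m * L ^ k) M) × Fin (d + 1) → ℝ}

omit [NeZero L] in
/-- `𝔇` is additive in its pair: `𝔇^{τ,τ}(A′ − B′, A − B) = 𝔇^{τ,τ}(A′, A) − 𝔇^{τ,τ}(B′, B)` — so `𝔇(W′, W) = 𝔇(E₀′, E₀) − 𝔇(G′, G)`. [folklore] -/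
theorem idef_sub_sub {X X' : Type} (τ : (X → ℝ) →ₗ[ℝ] (X' → ℝ)) (A' B' : (X' → ℝ) →ₗ[ℝ] (X' → ℝ)) (A B : (X → ℝ) →ₗ[ℝ] (X → ℝ)) :
    idef τ τ (A' - B') (A - B) = idef τ τ A' A - idef τ τ B' B := by
  unfold idef
  rw [LinearMap.sub_comp, LinearMap.comp_sub]
  abel

/-- **THE THREE-TERM SPLIT** of the η-difference of the middle factor (`P = pull kingPrV` King's prolongation, `W = E₀ − G`):
`Z′ − Z = Q′W′(Q′* − PQ*) + Q′·𝔇^P(W′, W)·Q* + (Q′P − Q)WQ*`. [cite: King1986, p.664 (the pairing `x′ ∈ B^n(x)`: shape)] [folklore] -/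
theorem zOp_sub_eq :
    zOp d M (L ^ m * L ^ k) b c' a' - zOp d M (L ^ k) b c a =
      qvRe M (L ^ m * L ^ k) ∘ₗ (wOp d M (L ^ m * L ^ k) b c' a' ∘ₗ ((qvAdjRe M (L ^ m * L ^ k) - pull (kingPrV L k m M) ∘ₗ qvAdjRe M (L ^ k)) ∘ₗ LinearMap.id))
      + qvRe M (L ^ m * L ^ k) ∘ₗ (idef (pull (kingPrV L k m M)) (pull (kingPrV L k m M)) (wOp d M (L ^ m * L ^ k) b c' a') (wOp d M (L ^ k) b c a) ∘ₗ qvAdjRe M (L ^ k))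
      + (qvRe M (L ^ m * L ^ k) ∘ₗ pull (kingPrV L k m M) - qvRe M (L ^ k)) ∘ₗ (wOp d M (L ^ k) b c a ∘ₗ qvAdjRe M (L ^ k)) := by
  unfold zOp idef
  simp only [LinearMap.comp_id, LinearMap.comp_sub, LinearMap.sub_comp, LinearMap.comp_assoc]
  abel

/-- ★★ **THE η-DIFFERENCE OF THE MIDDLE FACTOR.**  Data on one torus (`k`, refinement `m`, `σ > 0`, `2σ ≤ ρ`): the fine increment's majorant `W′ ≤ β_W·e^{−ρd}` (King's fine blocks),
the two-grid defect of the increment `𝔇^P(W′, W) ≤ m_W·e^{−ρd}` (`= 𝔇(E₀′(U), E₀(Ū)) − 𝔇(G′, G)`: the operator layer's background-live entry 0 minus entry 0 — supplied by file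
U-C2), and the gradient letter `(L^k)⁻¹ρ(sD_κ)∘W∘Q* ≤ β_D·e^{−ρd}` of §2; CONCLUSION: `Z′(U) − Z(Ū) ≤ [2e^{ρ}∕L^k·β_W·c_r·e^{ρ−σ} + m_W·e^{ρ}·c_r·e^{ρ−σ} + β_D·e^{ρ}]·e^{−(ρ−σ)d}`
on unit 1-forms blocked by their site — every term with a gain. [cite: King1986, Lemma 4.5 (4.38) p.674 (shape); Balaban1984PropagatorsI, (1.18) p.20] -/
theorem hasMaj_zOp_sub {βW mW βD σ ρ : ℝ} (hβW : 0 ≤ βW) (hmW : 0 ≤ mW) (hβD : 0 ≤ βD) (hσ : 0 < σ) (hσρ : 2 * σ ≤ ρ)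
    (hW' : HasMaj (BlockNorm.ofBlocks (unitTorusGeo L k M) (fun i : Tor (fine (L ^ m * L ^ k) M) × Fin (d + 1) => blockOf (L ^ m * L ^ k) M i.1))
      (BlockNorm.ofBlocks (unitTorusGeo L k M) (fun i : Tor (fine (L ^ m * L ^ k) M) × Fin (d + 1) => blockOf (L ^ m * L ^ k) M i.1))
      (wOp d M (L ^ m * L ^ k) b c' a') (fun y y' => βW * Real.exp (-(ρ * tdistT M y y'))))
    (hE : HasMaj (BlockNorm.ofBlocks (unitTorusGeo L k M) (blkFine L k M))
      (BlockNorm.ofBlocks (unitTorusGeo L k M) (fun i : Tor (fine (L ^ m * L ^ k) M) × Fin (d + 1) => blockOf (L ^ m * L ^ k) M i.1))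
      (idef (pull (kingPrV L k m M)) (pull (kingPrV L k m M)) (wOp d M (L ^ m * L ^ k) b c' a') (wOp d M (L ^ k) b c a))
      (fun y y' => mW * Real.exp (-(ρ * tdistT M y y'))))
    (hDW : ∀ κ : Fin (d + 1), HasMaj (BlockNorm.ofBlocks (unitTorusGeo L k M) (fun bb : Tor M × Fin (d + 1) => bb.1)) (BlockNorm.ofBlocks (unitTorusGeo L k M) (blkFine L k M))
      ((((L ^ k : ℕ) : ℝ)⁻¹ • symbOp M (L ^ k) (sD M (L ^ k) κ ((L ^ k : ℕ) : ℝ))) ∘ₗ (wOp d M (L ^ k) b c a ∘ₗ qvAdjRe M (L ^ k)))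
      (fun y y' => βD * Real.exp (-(ρ * tdistT M y y')))) :
    HasMaj (BlockNorm.ofBlocks (unitTorusGeo L k M) (fun bb : Tor M × Fin (d + 1) => bb.1)) (BlockNorm.ofBlocks (unitTorusGeo L k M) (fun bb : Tor M × Fin (d + 1) => bb.1))
      (zOp d M (L ^ m * L ^ k) b c' a' - zOp d M (L ^ k) b c a)
      (fun y y' => (1 * βW * (2 * Real.exp ρ / (L : ℝ) ^ k * 1) * latticeConst (d + 1) σ * Real.exp (ρ - σ)
          + 1 * mW * (1 * Real.exp ρ) * latticeConst (d + 1) σ * Real.exp (ρ - σ) + βD * Real.exp ρ) * Real.exp (-((ρ - σ) * tdistT M y y'))) := by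
  have htri := triangle254_unitTorusGeo (L := L) (k := k) (M := M)
  have hd := unitTorusGeo_dist_nonneg (L := L) (k := k) (M := M)
  have hrow := rowSum_unitTorusGeo (L := L) (k := k) (M := M) hσ
  have hρ : 0 ≤ ρ := by linarith
  have hK0 := latticeConst_nonneg (d + 1) hσ.le
  have hL0 : (0 : ℝ) < L := by exact_mod_cast Nat.pos_of_ne_zero (NeZero.ne L)
  -- the identity on unit 1-forms blocked by sites
  have hid := hasMaj_id_ofBlocks (g := unitTorusGeo L k M) (fun bb : Tor M × Fin (d + 1) => bb.1) (unitTorusGeo_dist_self (L := L) (k := k) (M := M)) ρ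
  -- T1 = Q′∘(W′∘((Q′* − PQ*)∘id))
  have h1a := hasMaj_qvAdjRe_sub_pull_comp M k m (B := 1) (ρ := ρ) zero_le_one hρ hid
  have h1b := hasMaj_comp_exp htri hd hrow hβW (by positivity) (ρ := ρ - σ) (by linarith) (by linarith) (by linarith) hW' h1a
  have h1 := hasMaj_qvRe_comp M k (L ^ m * L ^ k) (B := 1 * βW * (2 * Real.exp ρ / (L : ℝ) ^ k * 1) * latticeConst (d + 1) σ) (ρ := ρ - σ)
    (by positivity) (by linarith) (h1b.mono fun y y' => le_of_eq (by rw [kappa_ofBlocks]))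
  -- T2 = Q′∘(𝔇(W′,W)∘Q*)
  have h2a : HasMaj (BlockNorm.ofBlocks (unitTorusGeo L k M) (fun bb : Tor M × Fin (d + 1) => bb.1)) (BlockNorm.ofBlocks (unitTorusGeo L k M) (blkFine L k M))
      (qvAdjRe M (L ^ k)) (fun y y' => 1 * Real.exp ρ * Real.exp (-(ρ * tdistT M y y'))) := hasMaj_qvAdjRe (L := L) (M := M) (k := k) (n := L ^ k) hρ
  have h2b := hasMaj_comp_exp htri hd hrow hmW (by positivity) (ρ := ρ - σ) (by linarith) (by linarith) (by linarith) hE h2a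
  have h2 := hasMaj_qvRe_comp M k (L ^ m * L ^ k) (B := 1 * mW * (1 * Real.exp ρ) * latticeConst (d + 1) σ) (ρ := ρ - σ)
    (by positivity) (by linarith) (h2b.mono fun y y' => le_of_eq (by rw [kappa_ofBlocks]))
  -- T3 = (Q′P − Q)∘(W∘Q*)
  have h3 := hasMaj_qvRe_pull_sub_comp M k m (B := βD) (ρ := ρ) hβD hρ hDW
  -- sum
  rw [zOp_sub_eq (M := M) k m]
  refine ((h1.add h2).add h3).mono fun y y' => ?_
  have hdy := tdistT_nonneg M y y'
  have hexp : Real.exp (-(ρ * tdistT M y y')) ≤ Real.exp (-((ρ - σ) * tdistT M y y')) := Real.exp_le_exp.mpr (by nlinarith)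
  have hT3 : βD * Real.exp ρ * Real.exp (-(ρ * tdistT M y y')) ≤ βD * Real.exp ρ * Real.exp (-((ρ - σ) * tdistT M y y')) :=
    mul_le_mul_of_nonneg_left hexp (by positivity)
  have e : (1 * βW * (2 * Real.exp ρ / (L : ℝ) ^ k * 1) * latticeConst (d + 1) σ * Real.exp (ρ - σ)
          + 1 * mW * (1 * Real.exp ρ) * latticeConst (d + 1) σ * Real.exp (ρ - σ) + βD * Real.exp ρ) * Real.exp (-((ρ - σ) * tdistT M y y'))
      = 1 * βW * (2 * Real.exp ρ / (L : ℝ) ^ k * 1) * latticeConst (d + 1) σ * Real.exp (ρ - σ) * Real.exp (-((ρ - σ) * tdistT M y y'))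
        + 1 * mW * (1 * Real.exp ρ) * latticeConst (d + 1) σ * Real.exp (ρ - σ) * Real.exp (-((ρ - σ) * tdistT M y y'))
        + βD * Real.exp ρ * Real.exp (-((ρ - σ) * tdistT M y y')) := by ring
  rw [e]
  exact add_le_add le_rfl hT3

end Difference


end Summit.QuantumFields.YangMills.BalabanUVNodes.N15.UnitLayerBg

end
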